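import Mathlib
import Literature.NumberTheory.LFunctions.Zhang2022.SkeletonPartThree
import Literature.NumberTheory.LFunctions.Zhang2022.TypedAppendixB
import Literature.NumberTheory.LFunctions.Zhang2022.AppendixBLemma151Residues
import Literature.NumberTheory.LFunctions.Zhang2022.AppendixBLemma151Cauchy

/-!
# Zhang (2022) Appendix B, proof of Lemma 15.1, `μ = 2`: the three circle integrals of the actual
# integrand `ζ(1+s)/ζ(1+s−β_j)·(P₂/l₁)ˢ/((log P₂)(s−β₇)²)` — the two-circle split, the residue at the
# double pole `β₇` (`StepB_u011a`, EXACT), and the residue at `0` in its true form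

Topic `Literature/NumberTheory/LFunctions/Zhang2022` (Landau–Siegel audit tree; verdict-neutral).
Y. Zhang, *Discrete mean estimates and the Landau–Siegel zero*, arXiv:2211.02515v1 (2022)
[Zhang2022LandauSiegel] — **an unrefereed manuscript under adjudication.** Cell siegel-zhang
(D-0069), DISCHARGE row D16 (Lemma 15.1), DAG nodes `Z22:§B.u009` (text), `Z22:§B.u010` (first
equality), `Z22:§B.u011` (first line) [Z22 p.107, tex L5296–5309]; typed by L4-t10 as
`Typed.AppendixB.StepB_u009r/u010a/u011a` over `intB2 c′ D j l₁ s = zetaRatio·kerB`.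

Off `s = 0` and `s = β_j` the integrand is `G(s)/(s(s−β₇)²)` with
`G(s) = ζ₁(1+s)(s−β_j)ζ₁(1+s−β_j)⁻¹(P₂/l₁)ˢ/log P₂` HOLOMORPHIC on `|s| < 6α` for large `D` (Mathlib's
`riemannZeta₁`; `zeta1_near_one`); at `s = β_j` the typed `intB2` carries Mathlib's junk value of `ζ(1)`
— one point, invisible to circle integrals (a.e. congruence). PROVED: `circleIntegrals_intB2` (the three
integrals `∮_{|s|=5α}, ∮_{|s|=α}, ∮_{|s−β₇|=α}` of `intB2` in closed form via `AppendixBLemma151Cauchy`),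
`intB2_circle_split` (**`∮_{|s|=5α} = ∮_{|s|=α} + ∮_{|s−β₇|=α}`**, the `hsplit` of
`Skeleton.stepB_mu2_rate_of`), `circleIntegral_intB2_zero_eq` (**the residue at `0` in its TRUE form**
`(2πi)⁻¹∮_{|s|=α} intB2 = resZero2·ζ₁(1−β_j)⁻¹`; the typed literal `StepB_u010a` "`= resZero2`" drops
`ζ₁(1−β_j)⁻¹ = 1 + O(α)`, L4-t10's FLAG), `circleIntegral_intB2_zero_sub_resZero2_le` (`h10a`:
`‖… − resZero2‖ ≤ C·α`).

WHAT THIS IS NOT: the contour shift `StepB_u009r`, the VALUE of the `β₇`-residue (`StepB_u011b`),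
Lemma 15.1, or any claim about Theorems 1–2 / Landau–Siegel zeros. Reference: Y. Zhang,
arXiv:2211.02515v1 (2022), App. B p. 107. [cite: Zhang2022LandauSiegel, App. B p.107]
-/

noncomputable section

open Complex Real Metric Set Filter Topology

namespace Literature.NumberTheory.LFunctions.Zhang2022.Skeleton

open Typed.AppendixB (zetaRatio kerB intB2 resZero2 resBeta2)

section Circles

variable (c' : ℝ)

/-- `L₀ ≤ log D` once `D ≥ ⌈exp L₀⌉₊`. [folklore] -/
private theorem le_ell_of_ceil_exp_le' {L₀ : ℝ} {D : ℕ} (hD : ⌈Real.exp L₀⌉₊ ≤ D) : L₀ ≤ ell D := by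
  have h : Real.exp L₀ ≤ D := le_trans (Nat.le_ceil _) (by exact_mod_cast hD)
  exact (Real.le_log_iff_exp_le (lt_of_lt_of_le (Real.exp_pos _) h)).mpr h

/-- The size facts at a large modulus used throughout: `α > 0`, `α𝓛 = π/𝓛⁸`, `α ≤ α𝓛/2`,
`|β_j| ≤ 4α`, `|β_j| ≥ α/2`, `|β₇ − β_j| ≥ α/4 > … `, given `𝓛 ≥ 2` and `60|c′|α𝓛 ≤ 1`.
[cite: Zhang2022LandauSiegel, §2 (2.13), (2.22)] -/
theorem betaJ_size {D : ℕ} (hℓ : 2 ≤ ell D) (hc : 60 * |c'| * (alpha D * ell D) ≤ 1) {j : ℕ}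
    (hj : j ∈ ({1, 2, 3} : Finset ℕ)) :
    0 < alpha D ∧ ‖betaJ c' D j‖ ≤ 4 * alpha D ∧ alpha D / 2 ≤ ‖betaJ c' D j‖ ∧
      alpha D / 4 ≤ ‖beta7 D - betaJ c' D j‖ ∧ ‖beta7 D‖ = 5 / 2 * alpha D := by
  have hℓ0 : 0 < ell D := by linarith
  have ha : 0 < alpha D := by
    rw [alpha, bigP, Real.log_exp]; exact div_pos Real.pi_pos (pow_pos hℓ0 _)
  obtain ⟨κ, hκ, hβ⟩ := betaJ_eq_of_mem c' D hj
  have hj' : (1 : ℝ) ≤ j ∧ (j : ℝ) ≤ 3 := by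
    simp only [Finset.mem_insert, Finset.mem_singleton] at hj
    rcases hj with rfl | rfl | rfl <;> norm_num
  set e : ℝ := κ * c' * alpha D * ell D with he
  have he' : |e| ≤ 1 / 12 := by
    rw [he, show κ * c' * alpha D * ell D = κ * (c' * (alpha D * ell D)) by ring, abs_mul, abs_mul,
      abs_of_pos (mul_pos ha hℓ0)]
    calc |κ| * (|c'| * (alpha D * ell D)) ≤ 5 * (|c'| * (alpha D * ell D)) := by gcongr
      _ ≤ 1 / 12 := by linarith
  have hnorm : ‖betaJ c' D j‖ = (j : ℝ) * alpha D * |1 + e| := by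
    rw [hβ, norm_mul, Complex.norm_I, mul_one, Complex.norm_real, Real.norm_eq_abs,
      abs_mul, abs_mul, abs_of_nonneg (by linarith : (0:ℝ) ≤ j), abs_of_pos ha]
  have h1e : 11 / 12 ≤ |1 + e| ∧ |1 + e| ≤ 13 / 12 := by
    constructor
    · calc (11 : ℝ) / 12 ≤ 1 - |e| := by linarith
        _ ≤ |1 + e| := by
          have := abs_add_le (1 + e) (-e); simp only [add_neg_cancel_right, abs_one, abs_neg] at this
          linarith
    · calc |1 + e| ≤ |1| + |e| := abs_add_le _ _
        _ ≤ 13 / 12 := by rw [abs_one]; linarith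
  have h7 : beta7 D = (((5 / 2 * alpha D : ℝ)) : ℂ) * I := by rw [beta7]; push_cast; ring
  refine ⟨ha, ?_, ?_, ?_, ?_⟩
  · rw [hnorm]
    calc (j : ℝ) * alpha D * |1 + e| ≤ 3 * alpha D * (13 / 12) := by
          gcongr
          · exact hj'.2
          · exact h1e.2
      _ ≤ 4 * alpha D := by linarith
  · rw [hnorm]
    calc alpha D / 2 ≤ 1 * alpha D * (11 / 12) := by linarith
      _ ≤ (j : ℝ) * alpha D * |1 + e| := by
          gcongr
          · exact hj'.1
          · exact h1e.1
  · rw [h7, hβ, ← sub_mul, norm_mul, Complex.norm_I, mul_one, ← Complex.ofReal_sub,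
      Complex.norm_real, Real.norm_eq_abs,
      show 5 / 2 * alpha D - (j : ℝ) * alpha D * (1 + e) = alpha D * (5 / 2 - j - j * e) by ring,
      abs_mul, abs_of_pos ha]
    have hje : |(j : ℝ) * e| ≤ 1 / 4 := by
      rw [abs_mul, abs_of_nonneg (by linarith : (0:ℝ) ≤ j)]
      calc (j : ℝ) * |e| ≤ 3 * (1 / 12) := by gcongr; exact hj'.2
        _ = 1 / 4 := by norm_num
    have hhalf : 1 / 2 ≤ |5 / 2 - (j : ℝ)| := by
      simp only [Finset.mem_insert, Finset.mem_singleton] at hj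
      rcases hj with rfl | rfl | rfl <;> norm_num [abs_of_pos, abs_of_neg]
    have : 1 / 4 ≤ |5 / 2 - (j : ℝ) - j * e| := by
      have := abs_sub_abs_le_abs_sub (5 / 2 - (j : ℝ)) (j * e)
      linarith
    calc alpha D / 4 = alpha D * (1 / 4) := by ring
      _ ≤ alpha D * |5 / 2 - (j : ℝ) - j * e| := by gcongr
  · rw [h7, norm_mul, Complex.norm_I, mul_one, Complex.norm_real, Real.norm_eq_abs,
      abs_of_pos (by positivity)]

/-- For `s ≠ 0`, `s ≠ β_j` (with `ζ₁(1+s−β_j) ≠ 0`, `log P₂ ≠ 0`):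
`intB2(s) = G(s)/(s(s−β₇)²)`, `G(s) = ζ₁(1+s)(s−β_j)ζ₁(1+s−β_j)⁻¹(P₂/l₁)ˢ/log P₂`
(`ζ(1+s) = s⁻¹ζ₁(1+s)`, Mathlib `riemannZeta_eq_inv_sub_mul`). [cite: Zhang2022LandauSiegel, App. B p.107] -/
theorem intB2_eq_G_div (D j l₁ : ℕ) {s : ℂ} (hs0 : s ≠ 0) (hsb : s ≠ betaJ c' D j)
    (hz : riemannZeta₁ (1 + s - betaJ c' D j) ≠ 0) (hL : (Real.log (P2 D) : ℂ) ≠ 0) :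
    intB2 c' D j l₁ s =
      (riemannZeta₁ (1 + s) * (s - betaJ c' D j) * (riemannZeta₁ (1 + s - betaJ c' D j))⁻¹ *
        ((P2 D / l₁ : ℝ) : ℂ) ^ s / (Real.log (P2 D) : ℂ)) / (s * (s - beta7 D) ^ 2) := by
  have h1 : (1 : ℂ) + s ≠ 1 := fun h => hs0 (by linear_combination h)
  have h2 : (1 : ℂ) + s - betaJ c' D j ≠ 1 := fun h => hsb (by linear_combination h)
  rw [intB2, zetaRatio, kerB, riemannZeta_eq_inv_sub_mul h1, riemannZeta_eq_inv_sub_mul h2]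
  have e1 : (1 : ℂ) + s - 1 = s := by ring
  have e2 : (1 : ℂ) + s - betaJ c' D j - 1 = s - betaJ c' D j := by ring
  rw [e1, e2]
  have hsb' : s - betaJ c' D j ≠ 0 := sub_ne_zero.mpr hsb
  field_simp

/-- The circle integrals of `intB2` do not see the removable point `s = β_j`: over any circle not
passing through `0` on which `ζ₁(1+s−β_j) ≠ 0`, `∮ intB2 = ∮ G(s)/(s(s−β₇)²)` (a.e. congruence; the
parametrisation hits `β_j` only countably often). [cite: Zhang2022LandauSiegel, App. B p.107] -/
theorem circleIntegral_intB2_eq_G (D j l₁ : ℕ) {c : ℂ} {R : ℝ} (hR : R ≠ 0)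
    (h0 : ∀ θ : ℝ, circleMap c R θ ≠ 0)
    (hz : ∀ θ : ℝ, riemannZeta₁ (1 + circleMap c R θ - betaJ c' D j) ≠ 0)
    (hL : (Real.log (P2 D) : ℂ) ≠ 0) :
    (∮ s in C(c, R), intB2 c' D j l₁ s) = ∮ s in C(c, R),
      (riemannZeta₁ (1 + s) * (s - betaJ c' D j) * (riemannZeta₁ (1 + s - betaJ c' D j))⁻¹ *
        ((P2 D / l₁ : ℝ) : ℂ) ^ s / (Real.log (P2 D) : ℂ)) / (s * (s - beta7 D) ^ 2) := by
  have hcount : (circleMap c R ⁻¹' {betaJ c' D j}).Countable :=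
    (Set.countable_singleton _).preimage_circleMap c hR
  refine intervalIntegral.integral_congr_ae ((hcount.ae_notMem _).mono fun θ hθ _ => ?_)
  have hθ' : circleMap c R θ ≠ betaJ c' D j := hθ
  simp only [intB2_eq_G_div c' D j l₁ (h0 θ) hθ' (hz θ) hL]

/-- `G` is holomorphic on `ball 0 r` as soon as `ζ₁(1+s−β_j) ≠ 0` there and `P₂/l₁ > 0`.
[cite: Zhang2022LandauSiegel, App. B p.107] -/
theorem differentiableOn_G (D j l₁ : ℕ) {r : ℝ} (hx : 0 < P2 D / l₁)
    (hz : ∀ s ∈ ball (0 : ℂ) r, riemannZeta₁ (1 + s - betaJ c' D j) ≠ 0) :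
    DifferentiableOn ℂ (fun s : ℂ =>
      riemannZeta₁ (1 + s) * (s - betaJ c' D j) * (riemannZeta₁ (1 + s - betaJ c' D j))⁻¹ *
        ((P2 D / l₁ : ℝ) : ℂ) ^ s / (Real.log (P2 D) : ℂ)) (ball (0 : ℂ) r) := by
  have hx' : ((P2 D / l₁ : ℝ) : ℂ) ≠ 0 := by exact_mod_cast hx.ne'
  have h1 : Differentiable ℂ fun s : ℂ => riemannZeta₁ (1 + s) :=
    differentiable_riemannZeta₁.comp (differentiable_id.const_add 1)
  have h2 : Differentiable ℂ fun s : ℂ => riemannZeta₁ (1 + s - betaJ c' D j) :=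
    differentiable_riemannZeta₁.comp ((differentiable_id.const_add 1).sub_const _)
  have h3 : Differentiable ℂ fun s : ℂ => ((P2 D / l₁ : ℝ) : ℂ) ^ s :=
    fun s => differentiableAt_id.const_cpow (Or.inl hx')
  refine DifferentiableOn.div_const ?_ _
  refine ((h1.differentiableOn.mul (differentiableOn_id.sub_const _)).mul ?_).mul h3.differentiableOn
  exact h2.differentiableOn.inv hz

/-- Everything "for `D` large": given the radius `δ` and constant `K` of `zeta1_near_one` and a
threshold `L₀ ≤ 𝓛` dominating `2`, `60π|c′|`, `10π/δ`, `8Kπ`: `𝓛 ≥ 2`, `60|c′|α𝓛 ≤ 1`, `10α ≤ δ`,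
`8Kα ≤ 1`, `log P₂ ≥ 𝓛⁹/4 > 0`. [cite: Zhang2022LandauSiegel, §2 (2.10), (2.21)] -/
theorem large_package {δ K : ℝ} (hδ : 0 < δ) (hK : 0 ≤ K) {D : ℕ}
    (hℓ : max (max 2 (60 * |c'| * π)) (max (10 * π / δ) (8 * K * π)) ≤ ell D) :
    2 ≤ ell D ∧ 60 * |c'| * (alpha D * ell D) ≤ 1 ∧ 10 * alpha D ≤ δ ∧ 8 * K * alpha D ≤ 1 ∧
      0 < alpha D ∧ alpha D ≤ π / ell D ∧ ell D ^ 9 / 4 ≤ Real.log (P2 D) := by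
  have hℓ2 : 2 ≤ ell D := le_trans (le_trans (le_max_left _ _) (le_max_left _ _)) hℓ
  have hcℓ : 60 * |c'| * π ≤ ell D := le_trans (le_trans (le_max_right _ _) (le_max_left _ _)) hℓ
  have hδℓ : 10 * π / δ ≤ ell D := le_trans (le_trans (le_max_left _ _) (le_max_right _ _)) hℓ
  have hKℓ : 8 * K * π ≤ ell D := le_trans (le_trans (le_max_right _ _) (le_max_right _ _)) hℓ
  have hℓ1 : 1 ≤ ell D := by linarith
  have hℓ0 : 0 < ell D := by linarith
  have hα : alpha D = π / ell D ^ 9 := by rw [alpha, bigP, Real.log_exp]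
  have hα0 : 0 < alpha D := by rw [hα]; positivity
  have hαle : alpha D ≤ π / ell D := by
    rw [hα]; exact div_le_div_of_nonneg_left Real.pi_pos.le hℓ0 (le_self_pow₀ hℓ1 (by norm_num))
  have hαℓ : alpha D * ell D ≤ π / ell D := by
    have : alpha D * ell D = π / ell D ^ 8 := by
      rw [hα, eq_div_iff (pow_ne_zero _ hℓ0.ne')]; field_simp
    rw [this]; exact div_le_div_of_nonneg_left Real.pi_pos.le hℓ0 (le_self_pow₀ hℓ1 (by norm_num))
  refine ⟨hℓ2, ?_, ?_, ?_, hα0, hαle, ?_⟩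
  · calc 60 * |c'| * (alpha D * ell D) ≤ 60 * |c'| * (π / ell D) := by gcongr
      _ = 60 * |c'| * π / ell D := by ring
      _ ≤ 1 := by rw [div_le_one hℓ0]; exact hcℓ
  · calc 10 * alpha D ≤ 10 * (π / ell D) := by gcongr
      _ = 10 * π / ell D := by ring
      _ ≤ δ := by
          rw [div_le_iff₀ hℓ0]; rw [div_le_iff₀ hδ] at hδℓ; linarith
  · calc 8 * K * alpha D ≤ 8 * K * (π / ell D) := by gcongr
      _ = 8 * K * π / ell D := by ring
      _ ≤ 1 := by rw [div_le_one hℓ0]; exact hKℓ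
  · rw [log_P2]
    have h11 : ell D ^ (1.1 : ℝ) ≤ ell D ^ 2 := by
      calc ell D ^ (1.1 : ℝ) ≤ ell D ^ (2 : ℝ) := Real.rpow_le_rpow_of_exponent_le hℓ1 (by norm_num)
        _ = ell D ^ 2 := by norm_cast
    have hℓ7 : (128 : ℝ) ≤ ell D ^ 7 := by
      calc (128 : ℝ) = 2 ^ 7 := by norm_num
        _ ≤ ell D ^ 7 := by gcongr
    have hℓ9 : 128 * ell D ^ 2 ≤ ell D ^ 9 := by
      have : ell D ^ 9 = ell D ^ 2 * ell D ^ 7 := by ring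
      rw [this]; nlinarith [pow_pos hℓ0 2]
    nlinarith

/-- **The three circles of the `μ = 2` computation in closed form**, for `D` large (threshold from
`zeta1_near_one` and `c′`), every `j ∈ {1,2,3}` and `l₁ ≥ 1`: with
`G(s) = ζ₁(1+s)(s−β_j)ζ₁(1+s−β_j)⁻¹(P₂/l₁)ˢ/log P₂`,
`(2πi)⁻¹∮_{|s|=5α} intB2 = G(0)/β₇² − G(β₇)/β₇² + G′(β₇)/β₇`,
`(2πi)⁻¹∮_{|s|=α} intB2 = G(0)/β₇²`, `(2πi)⁻¹∮_{|s−β₇|=α} intB2 = −G(β₇)/β₇² + G′(β₇)/β₇`.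
[cite: Zhang2022LandauSiegel, App. B p.107] -/
theorem circleIntegrals_intB2 : ∃ D₀ : ℕ, ∀ D : ℕ, D₀ ≤ D → ∀ j ∈ ({1, 2, 3} : Finset ℕ),
    ∀ l₁ : ℕ, 1 ≤ l₁ →
      let G : ℂ → ℂ := fun s =>
        riemannZeta₁ (1 + s) * (s - betaJ c' D j) * (riemannZeta₁ (1 + s - betaJ c' D j))⁻¹ *
          ((P2 D / l₁ : ℝ) : ℂ) ^ s / (Real.log (P2 D) : ℂ)
      (2 * π * I)⁻¹ * (∮ s in C((0 : ℂ), 5 * alpha D), intB2 c' D j l₁ s) =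
          G 0 / beta7 D ^ 2 - G (beta7 D) / beta7 D ^ 2 + deriv G (beta7 D) / beta7 D ∧
      (2 * π * I)⁻¹ * (∮ s in C((0 : ℂ), alpha D), intB2 c' D j l₁ s) = G 0 / beta7 D ^ 2 ∧
      (2 * π * I)⁻¹ * (∮ s in C(beta7 D, alpha D), intB2 c' D j l₁ s) =
          -(G (beta7 D) / beta7 D ^ 2) + deriv G (beta7 D) / beta7 D := by
  obtain ⟨δ, hδ, K, hK, hζ⟩ := zeta1_near_one
  refine ⟨max 8 ⌈Real.exp (max (max 2 (60 * |c'| * π)) (max (10 * π / δ) (8 * K * π)))⌉₊,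
    fun D hD j hj l₁ hl₁ => ?_⟩
  obtain ⟨hℓ2, hc, hδα, hKα, hα0, hαπ, hLlow⟩ :=
    large_package c' hδ hK (le_ell_of_ceil_exp_le' (le_trans (le_max_right _ _) hD))
  obtain ⟨-, hb4, hb2, hb7, hn7⟩ := betaJ_size c' hℓ2 hc hj
  have hℓ0 : 0 < ell D := by linarith
  set b := betaJ c' D j with hbdef
  set a := alpha D with hadef
  have hL0 : 0 < Real.log (P2 D) := lt_of_lt_of_le (by positivity) hLlow
  have hL : (Real.log (P2 D) : ℂ) ≠ 0 := by exact_mod_cast hL0.ne'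
  have hx : 0 < P2 D / l₁ := by
    have : 0 < P2 D := by
      rw [P2]; exact div_pos (Real.rpow_pos_of_pos (Real.exp_pos _) _) (pow_pos (Real.exp_pos _) _)
    have hl : (0 : ℝ) < l₁ := by exact_mod_cast hl₁
    positivity
  -- `ζ₁(1 + s − β_j) ≠ 0` for `‖s‖ < 6α`
  have hzU : ∀ s ∈ ball (0 : ℂ) (6 * a), riemannZeta₁ (1 + s - b) ≠ 0 := by
    intro s hs
    have hs' : ‖s‖ < 6 * a := by simpa using hs
    have : ‖s - b‖ ≤ δ := by
      calc ‖s - b‖ ≤ ‖s‖ + ‖b‖ := norm_sub_le _ _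
        _ ≤ 6 * a + 4 * a := by linarith
        _ ≤ δ := by linarith
    have := (hζ (s - b) this).2.2
    rwa [show (1 : ℂ) + (s - b) = 1 + s - b by ring] at this
  have hGd := differentiableOn_G c' D j l₁ hx hzU
  set G : ℂ → ℂ := fun s =>
    riemannZeta₁ (1 + s) * (s - b) * (riemannZeta₁ (1 + s - b))⁻¹ *
      ((P2 D / l₁ : ℝ) : ℂ) ^ s / (Real.log (P2 D) : ℂ) with hGdef
  have hU : IsOpen (ball (0 : ℂ) (6 * a)) := isOpen_ball
  -- geometry of the three circles
  have h7ne : beta7 D ≠ 0 := by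
    intro h; rw [h, norm_zero] at hn7; linarith
  have hbig0 : (0 : ℂ) ∈ ball (0 : ℂ) (5 * a) := mem_ball_self (by positivity)
  have hbig7 : beta7 D ∈ ball (0 : ℂ) (5 * a) := by
    rw [mem_ball_zero_iff, hn7]; linarith
  have hcl5 : closedBall (0 : ℂ) (5 * a) ⊆ ball (0 : ℂ) (6 * a) := closedBall_subset_ball (by linarith)
  have hcl1 : closedBall (0 : ℂ) a ⊆ ball (0 : ℂ) (6 * a) := closedBall_subset_ball (by linarith)
  have hcl7 : closedBall (beta7 D) a ⊆ ball (0 : ℂ) (6 * a) := by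
    intro s hs
    rw [mem_closedBall, dist_eq_norm] at hs
    rw [mem_ball_zero_iff]
    calc ‖s‖ = ‖(s - beta7 D) + beta7 D‖ := by ring_nf
      _ ≤ ‖s - beta7 D‖ + ‖beta7 D‖ := norm_add_le _ _
      _ < 6 * a := by rw [hn7]; linarith
  have hz0 : (0 : ℂ) ∈ ball (0 : ℂ) a := mem_ball_self hα0
  have h7out : beta7 D ∉ closedBall (0 : ℂ) a := by
    rw [mem_closedBall_zero_iff, hn7]; linarith
  have h0out : (0 : ℂ) ∉ closedBall (beta7 D) a := by
    rw [mem_closedBall, dist_comm, dist_zero_right, hn7]; linarith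
  have h77 : beta7 D ∈ ball (beta7 D) a := mem_ball_self hα0
  -- the circles avoid `0`, and `ζ₁ ≠ 0` on them
  have hsph : ∀ (c : ℂ) (R : ℝ), (∀ θ, ‖circleMap c R θ‖ ≤ 5 * a) →
      ∀ θ, riemannZeta₁ (1 + circleMap c R θ - b) ≠ 0 := by
    intro c R hR θ
    refine hzU _ ?_
    rw [mem_ball_zero_iff]; linarith [hR θ]
  have hnorm0 : ∀ R θ, ‖circleMap 0 R θ‖ = |R| := fun R θ => by simp
  have hnorm7 : ∀ θ, ‖circleMap (beta7 D) a θ - beta7 D‖ = a := fun θ => by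
    simp [abs_of_pos hα0]
  have e5 : (∮ s in C((0 : ℂ), 5 * a), intB2 c' D j l₁ s) =
      ∮ s in C((0 : ℂ), 5 * a), G s / (s * (s - beta7 D) ^ 2) := by
    refine circleIntegral_intB2_eq_G c' D j l₁ (by positivity) (fun θ h => ?_)
      (hsph 0 (5 * a) fun θ => by rw [hnorm0, abs_of_pos (by positivity)]) hL
    have := hnorm0 (5 * a) θ; rw [h, norm_zero, abs_of_pos (by positivity)] at this; linarith
  have e1 : (∮ s in C((0 : ℂ), a), intB2 c' D j l₁ s) =
      ∮ s in C((0 : ℂ), a), G s / (s * (s - beta7 D) ^ 2) := by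
    refine circleIntegral_intB2_eq_G c' D j l₁ hα0.ne' (fun θ h => ?_)
      (hsph 0 a fun θ => by rw [hnorm0, abs_of_pos hα0]; linarith) hL
    have := hnorm0 a θ; rw [h, norm_zero, abs_of_pos hα0] at this; linarith
  have e7 : (∮ s in C(beta7 D, a), intB2 c' D j l₁ s) =
      ∮ s in C(beta7 D, a), G s / (s * (s - beta7 D) ^ 2) := by
    refine circleIntegral_intB2_eq_G c' D j l₁ hα0.ne' (fun θ h => ?_)
      (hsph (beta7 D) a fun θ => ?_) hL
    · have := hnorm7 θ; rw [h, zero_sub, norm_neg, hn7] at this; linarith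
    · calc ‖circleMap (beta7 D) a θ‖ = ‖(circleMap (beta7 D) a θ - beta7 D) + beta7 D‖ := by ring_nf
        _ ≤ ‖circleMap (beta7 D) a θ - beta7 D‖ + ‖beta7 D‖ := norm_add_le _ _
        _ ≤ 5 * a := by rw [hnorm7, hn7]; linarith
  refine ⟨?_, ?_, ?_⟩
  · rw [e5]; exact cauchy_three_term hU hGd hcl5 hbig0 hbig7 h7ne
  · rw [e1]; exact cauchy_pole_zero_only hU hGd hcl1 hz0 h7out h7ne
  · rw [e7]; exact cauchy_pole_beta_only hU hGd hcl7 h0out h77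

/-- **The two-circle split** ("the right side is equal to the sum of the residues of the integrand at
`s = 0` and `s = β₇`"): for `D` large, `∮_{|s|=5α} intB2 = ∮_{|s|=α} intB2 + ∮_{|s−β₇|=α} intB2` —
the hypothesis `hsplit` of `Skeleton.stepB_mu2_rate_of`, PROVED. [cite: Zhang2022LandauSiegel, App. B p.107] -/
theorem intB2_circle_split : ForAllLarge fun D _ _ => ∀ j ∈ ({1, 2, 3} : Finset ℕ), ∀ l₁ : ℕ,
    1 ≤ l₁ → (∮ s in C((0 : ℂ), 5 * alpha D), intB2 c' D j l₁ s) =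
      (∮ s in C((0 : ℂ), alpha D), intB2 c' D j l₁ s) +
        ∮ s in C(beta7 D, alpha D), intB2 c' D j l₁ s := by
  obtain ⟨D₀, h⟩ := circleIntegrals_intB2 c'
  refine ⟨D₀, fun D _ χ hD _ _ j hj l₁ hl₁ => ?_⟩
  obtain ⟨h5, h1, h7⟩ := h D hD j hj l₁ hl₁
  have h2pi : (2 * π * I : ℂ)⁻¹ ≠ 0 := inv_ne_zero (by simp [Real.pi_ne_zero, I_ne_zero])
  apply mul_left_cancel₀ h2pi
  rw [mul_add, h5, h1, h7]
  ring

/-- **The residue at `s = 0` in its true form**: for `D` large,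
`(2πi)⁻¹∮_{|s|=α} intB2 = resZero2 · ζ₁(1−β_j)⁻¹` (`resZero2 = −β_j/(β₇² log P₂)`; the typed literal
`StepB_u010a` omits the factor `ζ₁(1−β_j)⁻¹ = (−β_j ζ(1−β_j))⁻¹ = 1 + O(α)`).
[cite: Zhang2022LandauSiegel, App. B p.107] -/
theorem circleIntegral_intB2_zero_eq : ForAllLarge fun D _ _ => ∀ j ∈ ({1, 2, 3} : Finset ℕ),
    ∀ l₁ : ℕ, 1 ≤ l₁ → (2 * π * I)⁻¹ * (∮ s in C((0 : ℂ), alpha D), intB2 c' D j l₁ s) =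
      resZero2 c' D j * (riemannZeta₁ (1 - betaJ c' D j))⁻¹ := by
  obtain ⟨D₀, h⟩ := circleIntegrals_intB2 c'
  refine ⟨D₀, fun D _ χ hD _ _ j hj l₁ hl₁ => ?_⟩
  obtain ⟨-, h1, -⟩ := h D hD j hj l₁ hl₁
  rw [h1, resZero2]
  simp only [add_zero, zero_sub, riemannZeta₁_one, one_mul, cpow_zero, mul_one]
  ring

/-- **`h10a` of the `μ = 2` assembly, PROVED**: for `D` large, `j ∈ {1,2,3}`, `l₁ ≥ 1`,
`‖(2πi)⁻¹∮_{|s|=α} intB2 − resZero2‖ ≤ (512K/(25π))·α` (`K` from `zeta1_near_one`):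
`|resZero2| = |β_j|/(|β₇|² log P₂) ≤ 64/(25π)` and `|ζ₁(1−β_j)⁻¹ − 1| ≤ 8K α`.
[cite: Zhang2022LandauSiegel, App. B p.107] -/
theorem circleIntegral_intB2_zero_sub_resZero2_le : ∃ C : ℝ, ForAllLarge fun D _ _ =>
    ∀ j ∈ ({1, 2, 3} : Finset ℕ), ∀ l₁ : ℕ, 1 ≤ l₁ →
      ‖(2 * π * I)⁻¹ * (∮ s in C((0 : ℂ), alpha D), intB2 c' D j l₁ s) - resZero2 c' D j‖ ≤
        C * alpha D := by
  obtain ⟨δ, hδ, K, hK, hζ⟩ := zeta1_near_one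
  obtain ⟨D₀, h0⟩ := circleIntegral_intB2_zero_eq c'
  refine ⟨512 * K / (25 * π),
    max D₀ (max 8 ⌈Real.exp (max (max 2 (60 * |c'| * π)) (max (10 * π / δ) (8 * K * π)))⌉₊),
    fun D _ χ hD hq hp j hj l₁ hl₁ => ?_⟩
  have hD₀ : D₀ ≤ D := le_trans (le_max_left _ _) hD
  obtain ⟨hℓ2, hc, hδα, hKα, hα0, -, hLlow⟩ := large_package c' hδ hK
    (le_ell_of_ceil_exp_le' (le_trans (le_max_right _ _) (le_trans (le_max_right _ _) hD)))
  obtain ⟨-, hb4, -, -, hn7⟩ := betaJ_size c' hℓ2 hc hj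
  have hℓ0 : 0 < ell D := by linarith
  rw [h0 D χ hD₀ hq hp j hj l₁ hl₁]
  set b := betaJ c' D j with hb
  set w := riemannZeta₁ (1 - b) with hw
  have hw1 : ‖w - 1‖ ≤ 4 * K * alpha D := by
    have := (hζ (-b) (by rw [norm_neg]; linarith)).1
    rw [show (1 : ℂ) + -b = 1 - b by ring, norm_neg] at this
    calc ‖w - 1‖ ≤ K * ‖b‖ := this
      _ ≤ K * (4 * alpha D) := by gcongr
      _ = 4 * K * alpha D := by ring
  have hwlow : 1 / 2 ≤ ‖w‖ := by
    have h := norm_sub_norm_le (1 : ℂ) w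
    rw [norm_one, norm_sub_rev] at h
    linarith
  have hw0 : w ≠ 0 := by
    intro h; rw [h, norm_zero] at hwlow; linarith
  have hinv : ‖w⁻¹ - 1‖ ≤ 8 * K * alpha D := by
    have : w⁻¹ - 1 = w⁻¹ * (1 - w) := by field_simp
    rw [this, norm_mul, norm_inv, norm_sub_rev]
    calc ‖w‖⁻¹ * ‖w - 1‖ ≤ (1 / 2)⁻¹ * (4 * K * alpha D) :=
          mul_le_mul (inv_anti₀ (by norm_num) hwlow) hw1 (norm_nonneg _) (by norm_num)
      _ = 8 * K * alpha D := by ring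
  -- `|resZero2| ≤ 64/(25π)`
  have hL0 : 0 < Real.log (P2 D) := lt_of_lt_of_le (by positivity) hLlow
  have hres : ‖resZero2 c' D j‖ ≤ 64 / (25 * π) := by
    have h9 : alpha D * ell D ^ 9 = π := by
      rw [alpha, bigP, Real.log_exp, div_mul_cancel₀ _ (pow_ne_zero _ hℓ0.ne')]
    rw [resZero2, norm_div, norm_neg, norm_mul, norm_pow, Complex.norm_real, Real.norm_eq_abs,
      abs_of_pos hL0, hn7, ← hb]
    rw [div_le_div_iff₀ (by positivity) (by positivity)]
    calc ‖b‖ * (25 * π) ≤ 4 * alpha D * (25 * (alpha D * ell D ^ 9)) := by rw [h9]; gcongr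
      _ = 64 * ((5 / 2 * alpha D) ^ 2 * (ell D ^ 9 / 4)) := by ring
      _ ≤ 64 * ((5 / 2 * alpha D) ^ 2 * Real.log (P2 D)) := by gcongr
  calc ‖resZero2 c' D j * w⁻¹ - resZero2 c' D j‖ = ‖resZero2 c' D j‖ * ‖w⁻¹ - 1‖ := by
        rw [← norm_mul]; ring_nf
    _ ≤ 64 / (25 * π) * (8 * K * alpha D) := by gcongr
    _ = 512 * K / (25 * π) * alpha D := by ring

end Circles

end Literature.NumberTheory.LFunctions.Zhang2022.Skeleton
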